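import Summits.CriticalPhenomena.PercolationContinuityZ3.Theorems.PercNearOneGluingNoHeavyLowerTailAttachedChampionObserverExchange
import HarnessLib

/-!
# `NoHeavyLowerTail` (stmt-CriticalPhenomena-4575) — the THIRD-PORT gluing response: a linear (union-bound) control
# of how much a bystander vertex loses lightness when two other vertices are glued

Support file (prover `prim-hp-7`, hull-port line, technique "k-cluster conditional association"; `--supports
stmt-CriticalPhenomena-4575`).  No definitions, no named facts, no sorries.

Notation: `μ = prodBernoulli w`, relays `A`, level `j`, `π(v) = {a ∈ A : v ↔ a}`, `v` LIGHT iff `|π(v)| ≤ j`.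
Gluing two vertices `y, z` (a weight-one edge between them, or — in the Steiner-region decomposition of the
attached-champion inequality XZ, memo ATTACHED-CHAMPION.md Add. 6 / lead gen1 LEAD-GEN1.md — a connection of the ports
`y, z` through a component of the observer's region) replaces the relay content of a third vertex `x` by
`π^{yz}(x) = π(x) ∪ 1{x ↔ y ∨ x ↔ z}·(π(y) ∪ π(z))`.

The tree's quantitative gluing response (`twoObserver_le_add_posPart`, QGR) bounds the champion's margin over the GLUED
BLOCK `{y,z}`.  For regions with `≥ 3` boundary relays the excess `E` of XZ also contains atoms "observer attached to the
port `x` while the ports `y, z` are glued elsewhere", whose response is the margin over the THIRD port `x` in `H + yz`;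
termwise control of that margin by the margins in `H` is false (seat memo run/shared/lean/prim/prim-hp-7/HP7-KCLUSTER.md, F2: `q` dominating `x, y, z` in
`H` does not dominate `x` in `H + yz`, exact 5-vertex witness, margin `−0.395`).  What does hold, and is recorded here, is
the linear DROP bound: the lightness LOST by any vertex `x` under the gluing is at most the total lightness lost by `y`
and by `z` themselves,

* `drop_subset` : `{x light, x glued-heavy} ⊆ {y light, |π(y) ∪ π(z)| > j} ∪ {z light, |π(y) ∪ π(z)| > j}`
  (on the left event `x ↔ y` or `x ↔ z`; if `x ↔ y` then `π(x) = π(y)` and `π^{yz}(x) = π(y) ∪ π(z)`);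
* `drop_le` : `μ{x light, x glued-heavy} ≤ μ{y light, |π(y)∪π(z)| > j} + μ{z light, |π(y)∪π(z)| > j}`;
* `light_sub_gluedLight_le` : the same in margin form,
  `μ{x light} − μ{x glued-light} ≤ (μ{y light} − μ{|π(y)∪π(z)| ≤ j}) + (μ{z light} − μ{|π(y)∪π(z)| ≤ j})`.

In the abstract `m = 3` analysis of XZ (seat memo, F3) these DROP rows are among the linear cluster-bookkeeping rows that,
with the two-observer transfer, QGR and the domination hypotheses, certify the level `j = 1` case for every sampled region
law, and that are provably insufficient from level `2` on (positive association of the outside law is then needed).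
-/

noncomputable section

namespace Summit.CriticalPhenomena.PercolationContinuityZ3.Theorems

open MeasureTheory Set Literature.Probability.LatticeModels Literature.Probability.Percolation
open scoped Classical BigOperators

variable {n : ℕ}

namespace ThirdPortDrop

/-- If `x ↔ y` then `π(x) = π(y)` as Finsets. -/
theorem filter_eq_of_reachable (A : Finset (Fin n)) {x y : Fin n} {ω : BondConfig (Fin n)}
    (h : (openGraph ω).Reachable x y) :
    (A.filter fun a => ω ∈ openConn x a) = (A.filter fun a => ω ∈ openConn y a) := by
  apply Finset.filter_congr
  intro a _
  constructor
  · intro ha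
    change (openGraph ω).Reachable y a
    exact h.symm.trans ha
  · intro ha
    change (openGraph ω).Reachable x a
    exact h.trans ha

/-- If `x ↔ y` then the relay content of `x` after gluing `y, z` is `π(y) ∪ π(z)`. -/
theorem glued_filter_eq_of_reachable_left (A : Finset (Fin n)) {x y z : Fin n} {ω : BondConfig (Fin n)}
    (h : (openGraph ω).Reachable x y) :
    (A.filter fun a => ω ∈ openConn x a ∨
        ((ω ∈ openConn x y ∨ ω ∈ openConn x z) ∧ (ω ∈ openConn y a ∨ ω ∈ openConn z a))) =
      (A.filter fun a => ω ∈ openConn y a ∨ ω ∈ openConn z a) := by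
  apply Finset.filter_congr
  intro a _
  have hxy : ω ∈ (openConn x y : Set (BondConfig (Fin n))) := h
  constructor
  · rintro (ha | ⟨_, ha⟩)
    · left
      change (openGraph ω).Reachable y a
      exact h.symm.trans ha
    · exact ha
  · intro ha
    exact Or.inr ⟨Or.inl hxy, ha⟩

/-- If `x ↔ z` then the relay content of `x` after gluing `y, z` is `π(y) ∪ π(z)`. -/
theorem glued_filter_eq_of_reachable_right (A : Finset (Fin n)) {x y z : Fin n} {ω : BondConfig (Fin n)}
    (h : (openGraph ω).Reachable x z) :
    (A.filter fun a => ω ∈ openConn x a ∨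
        ((ω ∈ openConn x y ∨ ω ∈ openConn x z) ∧ (ω ∈ openConn y a ∨ ω ∈ openConn z a))) =
      (A.filter fun a => ω ∈ openConn y a ∨ ω ∈ openConn z a) := by
  apply Finset.filter_congr
  intro a _
  have hxz : ω ∈ (openConn x z : Set (BondConfig (Fin n))) := h
  constructor
  · rintro (ha | ⟨_, ha⟩)
    · right
      change (openGraph ω).Reachable z a
      exact h.symm.trans ha
    · exact ha
  · intro ha
    exact Or.inr ⟨Or.inr hxz, ha⟩

/-- If `x` is joined to neither `y` nor `z`, gluing `y, z` does not change the relay content of `x`. -/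
theorem glued_filter_eq_of_not_reachable (A : Finset (Fin n)) {x y z : Fin n} {ω : BondConfig (Fin n)}
    (hy : ¬ (openGraph ω).Reachable x y) (hz : ¬ (openGraph ω).Reachable x z) :
    (A.filter fun a => ω ∈ openConn x a ∨
        ((ω ∈ openConn x y ∨ ω ∈ openConn x z) ∧ (ω ∈ openConn y a ∨ ω ∈ openConn z a))) =
      (A.filter fun a => ω ∈ openConn x a) := by
  apply Finset.filter_congr
  intro a _
  constructor
  · rintro (ha | ⟨hxyz, _⟩)
    · exact ha
    · rcases hxyz with h | h
      · exact absurd h hy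
      · exact absurd h hz
  · intro ha
    exact Or.inl ha

/-- **Third-port drop, event form.**  `{x light, x glued-heavy} ⊆ {y light, |π(y)∪π(z)| > j} ∪ {z light, |π(y)∪π(z)| > j}`. -/
theorem drop_subset (A : Finset (Fin n)) (x y z : Fin n) (j : ℕ) :
    {ω : BondConfig (Fin n) | (A.filter fun a => ω ∈ openConn x a).card ≤ j ∧
        j < (A.filter fun a => ω ∈ openConn x a ∨
          ((ω ∈ openConn x y ∨ ω ∈ openConn x z) ∧ (ω ∈ openConn y a ∨ ω ∈ openConn z a))).card} ⊆
      {ω : BondConfig (Fin n) | (A.filter fun a => ω ∈ openConn y a).card ≤ j ∧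
          j < (A.filter fun a => ω ∈ openConn y a ∨ ω ∈ openConn z a).card} ∪
      {ω : BondConfig (Fin n) | (A.filter fun a => ω ∈ openConn z a).card ≤ j ∧
          j < (A.filter fun a => ω ∈ openConn y a ∨ ω ∈ openConn z a).card} := by
  intro ω hω
  simp only [mem_setOf_eq] at hω
  obtain ⟨hlight, hheavy⟩ := hω
  by_cases hy : (openGraph ω).Reachable x y
  · left
    refine ⟨?_, ?_⟩
    · rw [← filter_eq_of_reachable A hy]; exact hlight
    · rw [← glued_filter_eq_of_reachable_left A hy]; exact hheavy
  · by_cases hz : (openGraph ω).Reachable x z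
    · right
      refine ⟨?_, ?_⟩
      · rw [← filter_eq_of_reachable A hz]; exact hlight
      · rw [← glued_filter_eq_of_reachable_right A hz]; exact hheavy
    · exfalso
      rw [glued_filter_eq_of_not_reachable A hy hz] at hheavy
      exact absurd hlight (not_le.mpr hheavy)

/-- **Third-port drop, measure form.**  For all vertices `x, y, z`, every `A`, `j`:
`μ{x light, x glued-heavy} ≤ μ{y light, |π(y)∪π(z)| > j} + μ{z light, |π(y)∪π(z)| > j}`. -/
theorem drop_le (w : Sym2 (Fin n) → unitInterval) (A : Finset (Fin n)) (x y z : Fin n) (j : ℕ) :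
    (prodBernoulli w).real {ω : BondConfig (Fin n) | (A.filter fun a => ω ∈ openConn x a).card ≤ j ∧
        j < (A.filter fun a => ω ∈ openConn x a ∨
          ((ω ∈ openConn x y ∨ ω ∈ openConn x z) ∧ (ω ∈ openConn y a ∨ ω ∈ openConn z a))).card} ≤
      (prodBernoulli w).real {ω : BondConfig (Fin n) | (A.filter fun a => ω ∈ openConn y a).card ≤ j ∧
          j < (A.filter fun a => ω ∈ openConn y a ∨ ω ∈ openConn z a).card} +
      (prodBernoulli w).real {ω : BondConfig (Fin n) | (A.filter fun a => ω ∈ openConn z a).card ≤ j ∧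
          j < (A.filter fun a => ω ∈ openConn y a ∨ ω ∈ openConn z a).card} := by
  calc (prodBernoulli w).real _
      ≤ (prodBernoulli w).real ({ω : BondConfig (Fin n) | (A.filter fun a => ω ∈ openConn y a).card ≤ j ∧
          j < (A.filter fun a => ω ∈ openConn y a ∨ ω ∈ openConn z a).card} ∪
        {ω : BondConfig (Fin n) | (A.filter fun a => ω ∈ openConn z a).card ≤ j ∧
          j < (A.filter fun a => ω ∈ openConn y a ∨ ω ∈ openConn z a).card}) :=
        measureReal_mono (drop_subset A x y z j)
    _ ≤ _ := measureReal_union_le _ _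

/-- The glued-light event is contained in the light event (gluing only adds relays). -/
theorem gluedLight_subset_light (A : Finset (Fin n)) (x y z : Fin n) (j : ℕ) :
    {ω : BondConfig (Fin n) | (A.filter fun a => ω ∈ openConn x a ∨
          ((ω ∈ openConn x y ∨ ω ∈ openConn x z) ∧ (ω ∈ openConn y a ∨ ω ∈ openConn z a))).card ≤ j} ⊆
      {ω : BondConfig (Fin n) | (A.filter fun a => ω ∈ openConn x a).card ≤ j} := by
  intro ω hω
  refine le_trans (Finset.card_le_card ?_) hω
  intro a ha
  rw [Finset.mem_filter] at ha ⊢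
  exact ⟨ha.1, Or.inl ha.2⟩

/-- The union-light event `{|π(y) ∪ π(z)| ≤ j}` is contained in `{y light}`. -/
theorem unionLight_subset_light_left (A : Finset (Fin n)) (y z : Fin n) (j : ℕ) :
    {ω : BondConfig (Fin n) | (A.filter fun a => ω ∈ openConn y a ∨ ω ∈ openConn z a).card ≤ j} ⊆
      {ω : BondConfig (Fin n) | (A.filter fun a => ω ∈ openConn y a).card ≤ j} := by
  intro ω hω
  refine le_trans (Finset.card_le_card ?_) hω
  intro a ha
  rw [Finset.mem_filter] at ha ⊢
  exact ⟨ha.1, Or.inl ha.2⟩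

/-- The union-light event `{|π(y) ∪ π(z)| ≤ j}` is contained in `{z light}`. -/
theorem unionLight_subset_light_right (A : Finset (Fin n)) (y z : Fin n) (j : ℕ) :
    {ω : BondConfig (Fin n) | (A.filter fun a => ω ∈ openConn y a ∨ ω ∈ openConn z a).card ≤ j} ⊆
      {ω : BondConfig (Fin n) | (A.filter fun a => ω ∈ openConn z a).card ≤ j} := by
  intro ω hω
  refine le_trans (Finset.card_le_card ?_) hω
  intro a ha
  rw [Finset.mem_filter] at ha ⊢
  exact ⟨ha.1, Or.inr ha.2⟩

/-- Measure of a difference of nested events as a difference of measures (finite space). -/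
theorem real_diff_eq (w : Sym2 (Fin n) → unitInterval) {S T : Set (BondConfig (Fin n))} (h : T ⊆ S) :
    (prodBernoulli w).real (S \ T) = (prodBernoulli w).real S - (prodBernoulli w).real T := by
  have hmeas : MeasurableSet T := MeasurableSet.of_discrete
  rw [measureReal_sdiff h hmeas]

/-- **Third-port drop, margin form.**  For all vertices `x, y, z`:
`μ{x light} − μ{x glued-light} ≤ (μ{y light} − μ{|π(y)∪π(z)| ≤ j}) + (μ{z light} − μ{|π(y)∪π(z)| ≤ j})`. -/
theorem light_sub_gluedLight_le (w : Sym2 (Fin n) → unitInterval) (A : Finset (Fin n)) (x y z : Fin n) (j : ℕ) :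
    (prodBernoulli w).real {ω : BondConfig (Fin n) | (A.filter fun a => ω ∈ openConn x a).card ≤ j} -
      (prodBernoulli w).real {ω : BondConfig (Fin n) | (A.filter fun a => ω ∈ openConn x a ∨
          ((ω ∈ openConn x y ∨ ω ∈ openConn x z) ∧ (ω ∈ openConn y a ∨ ω ∈ openConn z a))).card ≤ j} ≤
      ((prodBernoulli w).real {ω : BondConfig (Fin n) | (A.filter fun a => ω ∈ openConn y a).card ≤ j} -
        (prodBernoulli w).real {ω : BondConfig (Fin n) |
          (A.filter fun a => ω ∈ openConn y a ∨ ω ∈ openConn z a).card ≤ j}) +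
      ((prodBernoulli w).real {ω : BondConfig (Fin n) | (A.filter fun a => ω ∈ openConn z a).card ≤ j} -
        (prodBernoulli w).real {ω : BondConfig (Fin n) |
          (A.filter fun a => ω ∈ openConn y a ∨ ω ∈ openConn z a).card ≤ j}) := by
  -- rewrite the three differences as measures of set differences, which are the events of `drop_le`
  rw [← real_diff_eq w (gluedLight_subset_light A x y z j),
    ← real_diff_eq w (unionLight_subset_light_left A y z j),
    ← real_diff_eq w (unionLight_subset_light_right A y z j)]
  have e1 : {ω : BondConfig (Fin n) | (A.filter fun a => ω ∈ openConn x a).card ≤ j} \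
      {ω : BondConfig (Fin n) | (A.filter fun a => ω ∈ openConn x a ∨
          ((ω ∈ openConn x y ∨ ω ∈ openConn x z) ∧ (ω ∈ openConn y a ∨ ω ∈ openConn z a))).card ≤ j} =
      {ω : BondConfig (Fin n) | (A.filter fun a => ω ∈ openConn x a).card ≤ j ∧
        j < (A.filter fun a => ω ∈ openConn x a ∨
          ((ω ∈ openConn x y ∨ ω ∈ openConn x z) ∧ (ω ∈ openConn y a ∨ ω ∈ openConn z a))).card} := by
    ext ω; simp only [mem_sdiff, mem_setOf_eq, not_le]
  have e2 : {ω : BondConfig (Fin n) | (A.filter fun a => ω ∈ openConn y a).card ≤ j} \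
      {ω : BondConfig (Fin n) | (A.filter fun a => ω ∈ openConn y a ∨ ω ∈ openConn z a).card ≤ j} =
      {ω : BondConfig (Fin n) | (A.filter fun a => ω ∈ openConn y a).card ≤ j ∧
          j < (A.filter fun a => ω ∈ openConn y a ∨ ω ∈ openConn z a).card} := by
    ext ω; simp only [mem_sdiff, mem_setOf_eq, not_le]
  have e3 : {ω : BondConfig (Fin n) | (A.filter fun a => ω ∈ openConn z a).card ≤ j} \
      {ω : BondConfig (Fin n) | (A.filter fun a => ω ∈ openConn y a ∨ ω ∈ openConn z a).card ≤ j} =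
      {ω : BondConfig (Fin n) | (A.filter fun a => ω ∈ openConn z a).card ≤ j ∧
          j < (A.filter fun a => ω ∈ openConn y a ∨ ω ∈ openConn z a).card} := by
    ext ω; simp only [mem_sdiff, mem_setOf_eq, not_le]
  rw [e1, e2, e3]
  exact drop_le w A x y z j

end ThirdPortDrop

end Summit.CriticalPhenomena.PercolationContinuityZ3.Theorems

end
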